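import Literature.Computability.Complexity.MurrayWilliams2018ExpLevel
import Literature.Computability.Complexity.TimeConstructibleClosure
import HarnessLib

/-!
# Murray–Williams 2018, Lemma 1.3 and Theorem 1.2 for `AC⁰[m]` from the Easy Witness Lemma in
# POLYLOGARITHMIC-SEED form (the form the tree's proved generator delivers)

Glue layer under the named fact `MurrayWilliams2018_thm_1_2_acc` (`MurrayWilliams2018.lean`;
C. D. Murray, R. R. Williams, *Circuit lower bounds for nondeterministic quasi-polytime: an easy
witness lemma for NP and NQP*, STOC 2018, Thm. 1.2 for the classes `AC⁰[m]`), whose discharge is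
`MurrayWilliams2018_thm_1_2_acc_of_EWL_of_expSimulation hEWL hN` (`MurrayWilliams2018ExpLevel.lean`)
once the easy witness lemma for `NQP` (`hEWL`, Lemma 1.3 at the tree's levels) and the
exponential-level simulation (`hN`) are theorems. The tree derives `hEWL` from the named fact
`MurrayWilliams2018_lemma_4_1_ae` (Lemma 4.1; `MurrayWilliams2018_lemma_1_3_of_lemma_4_1_ae`,
`MurrayWilliams2018Lemma13.lean`). This file records that a WEAKER form of Lemma 4.1 already gives
`hEWL`, and why that matters for the discharge:

* Lemma 4.1 as printed (and as `MurrayWilliams2018_lemma_4_1_ae` states it) has ONE exponent `e`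
  serving all size and time bounds `s`, `t`: the hypothesis is "`NTIME[O(t(n)ᵉ)] ⊂ SIZE[s(n)]`".
  Its proof (ECCC TR17-188, p. 13: "`N` will use `y_hard` as a hard function in the pseudorandom
  generator `G(·,·)` of Theorem 2.1 … enumerates all `s = |y_hard|ᵍ` seeds") uses Umans'
  generator, Thm. 2.1 there (p. 8: "There is a universal constant `g` and a function
  `G : {0,1}^{2^m} × {0,1}^{O(m)} → {0,1}ˢ` … computable in `poly(2^m)` time", for ALL hardnesses),
  whose seed length `O(m)`, `m ≈ log₂ |y_hard| ≈ log₂ t(n)`, is what keeps the enumeration of all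
  seeds inside `t^{O(1)}`. With a generator of seed length `c · m⁴` the same simulation runs in
  time `2^{c m⁴} · t(n)^{O(1)}`; for `s(n) = n²`, `t(n) = nᴰ` that is `n^{Θ(log³ n)} ⊄ NTIME[tᵉ]`,
  so the printed statement is out of reach of such a generator.
* The tree HAS such a generator, proved: the discrete form of Impagliazzo–Kabanets–Wigderson's
  Thm. 11 (the Nisan–Wigderson generator on a worst-case-to-average-case encoding of the table),
  `IKW2002_thm11_tableGenerator` (`IKWGeneratorsProofs.lean`): *`F ∈ FP` and `c` with, for all
  `m, n` and every `f : {0,1}ᵐ → {0,1}` of `B₂`-circuit complexity `> (n + m)ᶜ`,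
  `IsSizePseudorandom (tableGenerator F f (c · m⁴) n)`* — seed length `c · m⁴` at every hardness
  level; Umans' generator (Reed–Muller list decoding) is not in the tree.
* What this cone CONSUMES is not Lemma 4.1 but its case Lemma 1.3 (`hEWL`; the source, p. 13:
  "For `s(n) = 2^{(log n)ᵏ}`, `NQP ⊂ SIZE[2^{(log n)ᵏ}]` implies that `NQP` has witness circuits
  of size `2^{O((log n)^{k³})}`"), whose hypothesis covers every quasi-polynomial level at once.
  Running the printed proof of Lemma 4.1 (§4) with a generator of seed length `c · m⁴` changes
  one line of its resource analysis: the simulation `N` lies in `NTIME[T]` for any bound `T`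
  with `2^{C (log₂ t(n) + 2)^C} ≤ T(n)` almost everywhere (some constant `C`), instead of in
  `NTIME[tᵉ]`, so the `s`-size circuits must be assumed for `NTIME[T]`. For `t` quasi-polynomial
  such a `T` is again quasi-polynomial and Lemma 1.3 follows verbatim. We call the resulting
  statement **Lemma 4.1 in polylogarithmic-seed form** — hypothesis `hQ` of the theorems below.
  It is NOT vendored as a named fact (D-0026): it is implied by `MurrayWilliams2018_lemma_4_1_ae`
  (`lemma_4_1_qp_of_lemma_4_1_ae`, proved here) and it is the target to be PROVED, inline, from
  Thm. 3.1 of the source and `IKW2002_thm11_tableGenerator` by the files formalizing §4.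

Proved here (theorems only; no definition, no named fact is introduced):

* `qpExp_add_two_le`, `eventually_two_pow_mul_log_smoothQP_pow_le_smoothQP` — the arithmetic of
  the changed line at the smooth levels: `2^{C (log₂ (smoothQP E n) + 2)^C} ≤ smoothQP (C (E+1)) n`
  for all large `n` (`log₂ (smoothQP E n) = qpExp E n ≤ 3 (log₂ n + 2)^{E+1} - 2`);
* `NTIME_pow_subset_NTIME_of_eventually_le` — `NTIME (t · ^ e) ⊆ NTIME T` for time-constructible
  `t`, `T` with `tᵉ ≤ T` a.e. (the unary clock of `c · tᵉ + c`, `IsTimeConstructible.pow`,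
  `IsTimeConstructible.mul_add`, `exists_unaryClock_of_timeConstructible`, and the transport
  `NTIME_subset_of_clocks`), and `lemma_4_1_qp_of_lemma_4_1_ae` — the polylogarithmic-seed form
  is weaker than `MurrayWilliams2018_lemma_4_1_ae` (`tᵉ ≤ 2^{e (log₂ t + 2)ᵉ}`, take `C = e`);
* **`MurrayWilliams2018_lemma_1_3_of_lemma_4_1_qp`** — Lemma 1.3 at the tree's levels (`hEWL`
  verbatim) from the polylogarithmic-seed form: the derivation of
  `MurrayWilliams2018_lemma_1_3_of_lemma_4_1_ae` (`s = smoothQP k + id`, `t = smoothQP E`,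
  `E = (k+2)³ + e`, provisos (a), (b), witnesses descending by
  `NTIMEHasWitnessCircuits.of_smoothQP`) with `T = smoothQP (C (E+1))` and the assumed circuits
  supplied on `NTIME (smoothQP (C (E+1)))`, a subclass of the level `C (E+1) + 1`
  (`NTIME_smoothQP_pow_subset`);
* **`MurrayWilliams2018_thm_1_2_acc_of_lemma_4_1_qp_of_expSimulation`** — Theorem 1.2 for
  `AC⁰[m]` (`MurrayWilliams2018_thm_1_2_acc`) from the polylogarithmic-seed form and the
  exponential-level simulation `hN` of `MurrayWilliams2018ExpLevel.lean`
  (`MurrayWilliams2018_thm_1_2_acc_of_EWL_of_expSimulation`), and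
  `MurrayWilliams2018_NTIME_not_depth_ACC_of_lemma_4_1_qp_of_expSimulation` — Theorem 1.3
  (`MurrayWilliams2018_NTIME_not_depth_ACC`) from the same and Thm. 5.1
  (`MurrayWilliams2018_NTIME_not_depth_ACC_of_components`; Thm. 5.1 is the theorem
  `MurrayWilliams2018_thm_5_1_holds` of `Williams2014Proofs.lean`, not imported here to keep the
  import closure of this glue file small).

After this file the trust base of `MurrayWilliams2018_thm_1_2_acc` (hence of Thm. 1.3) is
{Lemma 4.1 in polylogarithmic-seed form — i.e. Thm. 3.1 of the source, the PROVED generator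
`IKW2002_thm11_tableGenerator` and the simulation `N` of §4 —, the exponential-level simulation
`hN`}; Umans' Thm. 2.1 is no longer on the path of this fact.

## Faithfulness notes

* Nothing printed is restated as a fact. Lemma 1.3 is read, as everywhere in this cone
  (`MurrayWilliams2018Hierarchy.lean`, hypothesis `hEWL`), with its hypothesis at ALL levels
  `NTIME (n ^ (log₂ n)ᵉ)`, `e ≥ 1` ("`NQP ⊂ SIZE[2^{logᵏ n}]`"), which is what absorbs a
  `2^{polylog t}` seed enumeration: `2^{C (log₂ (smoothQP E n) + 2)^C} ≤ smoothQP (C(E+1)) n` a.e.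
  The source's own overview of the method (§1.2, p. 5: "the hard function `yᵢ` can be used to
  power a pseudorandom generator `G` with `O(k²c log n)`-length seeds … running `G` on all seeds")
  is the Umans-seed bookkeeping; the statement below only weakens the class asked to have small
  circuits.
* The polylogarithmic-seed form keeps every other feature of `MurrayWilliams2018_lemma_4_1_ae`
  (the D-0026 review form: `s` strictly increasing and time constructible, `t` time
  constructible and non-decreasing, provisos (a) `n · s(n) < 2^{n/e}` and
  (b) `s₂(s₂(s₂(n)))ᵈ ≤ t(n)` almost everywhere, the hypothesis in the almost-everywhere form of
  `SIZE`, the conclusion `NTIMEHasWitnessCircuits t (s₂(s₂(s₂ n)))^{2g})`), adds the bound `T`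
  (time constructible, non-decreasing, `≥ 2^{C (log₂ t + 2)^C}` a.e.) with one more universal
  constant `C ≥ 1`, and asks the circuits of `NTIME T`. Constructibility and monotonicity of `T`
  are conveniences for its prover; the derivation supplies them (`isTimeConstructible_smoothQP`,
  `smoothQP_mono`).

## References

* C. D. Murray, R. R. Williams, *Circuit lower bounds for nondeterministic quasi-polytime: an
  easy witness lemma for NP and NQP*, STOC 2018, 890–901 (ECCC TR17-188), §1.2 (p. 5), Thm. 2.1
  (p. 8, Umans' generator), Lemma 1.3 and Lemma 4.1 with its proof (pp. 13–14: the simulation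
  `N`), §5 (proof of Thm. 1.2) [MurrayWilliams2018].
* R. Impagliazzo, V. Kabanets, A. Wigderson, *In search of an easy witness: exponential time vs.
  probabilistic polynomial time*, JCSS 65 (2002) 672–694, Thm. 11
  [ImpagliazzoKabanetsWigderson2002].
* C. Umans, *Pseudo-random generators for all hardnesses*, JCSS 67 (2003) 419–440, Thm. 1
  (quoted as MW Thm. 2.1).
* S. Arora, B. Barak, *Computational Complexity: A Modern Approach*, CUP 2009, §1.3
  (time-constructible functions), §2.1.2 and Thm. 2.6 (verifier form of `NTIME`, transport along
  clocks) [AroraBarak2009].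
-/

namespace Literature.Computability.Complexity

open Filter

/-! ### Arithmetic of the polylogarithmic seed at the smooth levels -/

/-- `qpExp E n + 2 ≤ 3 (log₂ n + 2)^{E+1}` (upper sandwich
`qpExp E n ≤ log₂ n + 1 + (log₂ n + 1)^{E+1}`). [folklore] -/
theorem qpExp_add_two_le (E n : ℕ) : qpExp E n + 2 ≤ 3 * (Nat.log 2 n + 2) ^ (E + 1) := by
  set L := Nat.log 2 n with hL
  have hq : qpExp E n ≤ L + 1 + (L + 1) ^ (E + 1) := qpExp_le E n
  have h1 : (L + 1) ^ (E + 1) ≤ (L + 2) ^ (E + 1) := Nat.pow_le_pow_left (by omega) _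
  have h2 : L + 2 ≤ (L + 2) ^ (E + 1) := Nat.le_self_pow (by omega) _
  omega

/-- **The seed enumeration is absorbed by a higher smooth level**: eventually
`2^{C (log₂ (smoothQP E n) + 2)^C} ≤ smoothQP (C (E + 1)) n`
(`log₂ (smoothQP E n) = qpExp E n`; `C (qpExp E n + 2)^C ≤ C 3^C (log₂ n + 2)^{(E+1)C} ≤
(log₂ n)^{(E+1)C+1} ≤ qpExp (C(E+1)) n` for large `n`). [folklore] -/
theorem eventually_two_pow_mul_log_smoothQP_pow_le_smoothQP (C E : ℕ) :
    ∀ᶠ n in atTop, 2 ^ (C * (Nat.log 2 (smoothQP E n) + 2) ^ C) ≤ smoothQP (C * (E + 1)) n := by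
  filter_upwards [eventually_mul_log_add_two_pow_le (C * 3 ^ C) ((E + 1) * C)] with n hn
  refine Nat.pow_le_pow_right two_pos ?_
  rw [log_smoothQP]
  have h1 : (qpExp E n + 2) ^ C ≤ (3 * (Nat.log 2 n + 2) ^ (E + 1)) ^ C :=
    Nat.pow_le_pow_left (qpExp_add_two_le E n) C
  calc C * (qpExp E n + 2) ^ C ≤ C * (3 * (Nat.log 2 n + 2) ^ (E + 1)) ^ C :=
        Nat.mul_le_mul_left C h1
    _ = C * 3 ^ C * (Nat.log 2 n + 2) ^ ((E + 1) * C) := by rw [mul_pow, ← pow_mul]; ring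
    _ ≤ Nat.log 2 n ^ ((E + 1) * C + 1) := hn
    _ = Nat.log 2 n ^ (C * (E + 1) + 1) := by rw [Nat.mul_comm (E + 1) C]
    _ ≤ qpExp (C * (E + 1)) n := pow_log_le_qpExp _ n

/-! ### The polylogarithmic-seed form is implied by Lemma 4.1 (a.e. form) -/

/-- `tᵉ ≤ 2 ^ (e (log₂ t + 2)ᵉ)` for `1 ≤ e` (`t < 2^{log₂ t + 1}`, `log₂ t + 1 ≤ (log₂ t + 2)ᵉ`).
[folklore] -/
theorem pow_le_two_pow_mul_log_add_two_pow (t : ℕ) {e : ℕ} (he : 1 ≤ e) :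
    t ^ e ≤ 2 ^ (e * (Nat.log 2 t + 2) ^ e) := by
  have h1 : t < 2 ^ (Nat.log 2 t + 1) := Nat.lt_pow_succ_log_self one_lt_two t
  have h2 : Nat.log 2 t + 1 ≤ (Nat.log 2 t + 2) ^ e :=
    (Nat.le_succ _).trans (Nat.le_self_pow (by omega) _)
  calc t ^ e ≤ (2 ^ (Nat.log 2 t + 1)) ^ e := Nat.pow_le_pow_left h1.le e
    _ = 2 ^ (e * (Nat.log 2 t + 1)) := by rw [← pow_mul, Nat.mul_comm]
    _ ≤ 2 ^ (e * (Nat.log 2 t + 2) ^ e) :=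
        Nat.pow_le_pow_right two_pos (Nat.mul_le_mul_left e h2)

/-- **`NTIME (t · ^ e) ⊆ NTIME T` for time-constructible `t`, `T` with `tᵉ ≤ T` almost
everywhere.** The unary clock `x ↦ ⟨x, 1^{c · t|x|ᵉ + c}⟩` of the time-constructible
`n ↦ c · t(n)ᵉ + c` (`IsTimeConstructible.pow`, `IsTimeConstructible.mul_add`,
`exists_unaryClock_of_timeConstructible`) runs in time `O(T)` up to an additive constant absorbing
the finitely many lengths where `tᵉ > T` (`exists_add_of_eventually_le`), so verifiers transport
(`NTIME_subset_of_clocks`; Arora–Barak, Thm. 2.6: cut the certificate at the old admissible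
length). [cite: AroraBarak2009, §2.1.2 and Thm. 2.6] -/
theorem NTIME_pow_subset_NTIME_of_eventually_le {t T : ℕ → ℕ} {e : ℕ}
    (ht : IsTimeConstructible t) (hT : IsTimeConstructible T) (he : 1 ≤ e)
    (hle : ∀ᶠ n in atTop, t n ^ e ≤ T n) : NTIME (fun n => t n ^ e) ⊆ NTIME T := by
  obtain ⟨A, hA⟩ := exists_add_of_eventually_le hle
  refine NTIME_subset_of_clocks fun c hc => ?_
  obtain ⟨N, a, hN⟩ := exists_unaryClock_of_timeConstructible ((ht.pow he).mul_add hc)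
  refine ⟨N, a * c + a * c * A + a + c * A + c + 1, fun x => (hN x).mono ?_, fun n => ?_,
    fun n => ?_⟩
  · have h := hA x.length
    calc a * (c * t x.length ^ e + c) + a ≤ a * (c * (T x.length + A) + c) + a := by gcongr
      _ = a * c * T x.length + (a * c * A + a * c + a) := by ring
      _ ≤ (a * c + a * c * A + a + c * A + c + 1) * T x.length
            + (a * c + a * c * A + a + c * A + c + 1) :=
          Nat.add_le_add (Nat.mul_le_mul_right _ (by omega)) (by omega)
  · have h := hA n
    calc c * t n ^ e + c ≤ c * (T n + A) + c := by gcongr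
      _ = c * T n + (c * A + c) := by ring
      _ ≤ (a * c + a * c * A + a + c * A + c + 1) * T n + (a * c + a * c * A + a + c * A + c + 1) :=
          Nat.add_le_add (Nat.mul_le_mul_right _ (by omega)) (by omega)
  · calc n ≤ T n := hT.1 n
      _ ≤ (a * c + a * c * A + a + c * A + c + 1) * T n := Nat.le_mul_of_pos_left _ (by omega)
      _ ≤ _ := Nat.le_add_right _ _

/-- **Lemma 4.1 (a.e. form) implies its polylogarithmic-seed form**: assuming `s`-size circuits
for `NTIME T` with `T ≥ 2^{C (log₂ t + 2)^C} ≥ tᵉ` a.e. (take `C = e`,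
`pow_le_two_pow_mul_log_add_two_pow`) is assuming them for a superclass of `NTIME (t · ^ e)`
(`NTIME_pow_subset_NTIME_of_eventually_le`). [cite: MurrayWilliams2018, Lemma 4.1] -/
theorem lemma_4_1_qp_of_lemma_4_1_ae (h41 : MurrayWilliams2018_lemma_4_1_ae) :
    ∃ e g d C : ℕ, 1 ≤ e ∧ 1 ≤ g ∧ 1 ≤ d ∧ 1 ≤ C ∧
      ∀ (s t T : ℕ → ℕ), StrictMono s → IsTimeConstructible s → IsTimeConstructible t →
        Monotone t → IsTimeConstructible T → Monotone T →
        (∀ᶠ n in atTop, n * s n < 2 ^ (n / e)) →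
        (∀ᶠ n in atTop, ((stretch s e)^[3] n) ^ d ≤ t n) →
        (∀ᶠ n in atTop, 2 ^ (C * (Nat.log 2 (t n) + 2) ^ C) ≤ T n) →
        (∀ L ∈ NTIME T, ∀ᶠ n in atTop, L.circuitSize n ≤ s n) →
          NTIMEHasWitnessCircuits t (fun n => ((stretch s e)^[3] n) ^ (2 * g)) := by
  obtain ⟨e, g, d, he, hg, hd, H⟩ := h41
  refine ⟨e, g, d, e, he, hg, hd, he, fun s t T hs hsc htc htm hTc _ ha hb hdom hsize => ?_⟩
  refine H s t hs hsc htc htm ha hb fun L hL => hsize L ?_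
  refine NTIME_pow_subset_NTIME_of_eventually_le htc hTc he ?_ hL
  exact hdom.mono fun n hn => (pow_le_two_pow_mul_log_add_two_pow (t n) he).trans hn

/-! ### Lemma 1.3 at the tree's levels from the polylogarithmic-seed form -/

/-- **Murray–Williams' easy witness lemma for `NQP` (Lemma 1.3), read at the tree's levels, from
Lemma 4.1 in polylogarithmic-seed form.** For every `k ≥ 1`: if every language of every level
`NTIME (n ^ (log₂ n)ᵉ)`, `e ≥ 1`, has circuits of size `2^{(log₂ n)ᵏ}` almost everywhere, then
for some `K` all levels have witness circuits of size `2^{(log₂ n)^K}` — hypothesis `hEWL` of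
`MurrayWilliams2018_thm_1_2_acc_of_EWL_of_expSimulation` verbatim. The derivation is that of
`MurrayWilliams2018_lemma_1_3_of_lemma_4_1_ae` (`MurrayWilliams2018Lemma13.lean`): `s = smoothQP k
+ id` (strictly increasing, time constructible, proviso (a) `eventually_mul_smoothQP_add_lt`),
`t = smoothQP E` with `E = (k+2)³ + e` (proviso (b) and the final size by the closure of the
bounds `2^{C (log₂ n + 2)^b}` under stretching and composition), the witnesses descending to the
level `e` by `NTIMEHasWitnessCircuits.of_smoothQP`; the one new point is the class asked to
have `s`-size circuits: `NTIME T` with `T = smoothQP (C (E+1))`, time constructible and monotone,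
`≥ 2^{C (log₂ t + 2)^C}` a.e. (`eventually_two_pow_mul_log_smoothQP_pow_le_smoothQP`), and
contained in the level `C (E+1) + 1` (`NTIME_smoothQP_pow_subset`), where the assumption
applies. (Source, p. 13: "For `s(n) = 2^{(log n)ᵏ}`, `NQP ⊂ SIZE[2^{(log n)ᵏ}]` implies that
`NQP` has witness circuits of size `2^{O((log n)^{k³})}`.")
[cite: MurrayWilliams2018, Lemma 1.3 and Lemma 4.1] -/
theorem MurrayWilliams2018_lemma_1_3_of_lemma_4_1_qp
    (hQ : ∃ e g d C : ℕ, 1 ≤ e ∧ 1 ≤ g ∧ 1 ≤ d ∧ 1 ≤ C ∧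
      ∀ (s t T : ℕ → ℕ), StrictMono s → IsTimeConstructible s → IsTimeConstructible t →
        Monotone t → IsTimeConstructible T → Monotone T →
        (∀ᶠ n in atTop, n * s n < 2 ^ (n / e)) →
        (∀ᶠ n in atTop, ((stretch s e)^[3] n) ^ d ≤ t n) →
        (∀ᶠ n in atTop, 2 ^ (C * (Nat.log 2 (t n) + 2) ^ C) ≤ T n) →
        (∀ L ∈ NTIME T, ∀ᶠ n in atTop, L.circuitSize n ≤ s n) →
          NTIMEHasWitnessCircuits t (fun n => ((stretch s e)^[3] n) ^ (2 * g))) :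
    ∀ k : ℕ, 1 ≤ k →
      (∀ e : ℕ, 1 ≤ e → ∀ L ∈ NTIME (fun n => n ^ Nat.log 2 n ^ e),
          ∀ᶠ n in atTop, L.circuitSize n ≤ 2 ^ Nat.log 2 n ^ k) →
        ∃ K e₀ : ℕ, 1 ≤ K ∧ ∀ e : ℕ, e₀ ≤ e →
          NTIMEHasWitnessCircuits (fun n => n ^ Nat.log 2 n ^ e) (fun n => 2 ^ Nat.log 2 n ^ K) := by
  intro k hk hS
  obtain ⟨eₗ, g, d, C, heₗ, -, -, hC, H⟩ := hQ
  -- the size function and the shape of its third stretch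
  have hs0 : ∀ n, (fun n => smoothQP k n + n) n ≤ 2 ^ (1 * (Nat.log 2 n + 2) ^ (k + 2)) :=
    smoothQP_add_le_two_pow k
  have hs1 := stretch_le_two_pow (f := fun n => smoothQP k n + n) hs0 eₗ
  have hs2 := comp_le_two_pow hs1 hs1
  obtain ⟨C₃, B, hB, hs3⟩ : ∃ C₃ B : ℕ, B = (k + 2) * (k + 2) * (k + 2) ∧
      ∀ n, (stretch (fun n => smoothQP k n + n) eₗ)^[3] n ≤ 2 ^ (C₃ * (Nat.log 2 n + 2) ^ B) :=
    ⟨_, _, rfl, fun n => comp_le_two_pow hs1 hs2 n⟩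
  have hB1 : 1 ≤ B := by rw [hB]; exact Nat.succ_le_of_lt (by positivity)
  refine ⟨B + 1, 1, by omega, fun e he => ?_⟩
  -- the smooth level for the level `e`, and the level absorbing the seed enumeration
  obtain ⟨E, hE⟩ : ∃ E : ℕ, E = B + e := ⟨_, rfl⟩
  have hE1 : 1 ≤ E := by omega
  have hEe : e + 1 ≤ E := by omega
  obtain ⟨E', hE'⟩ : ∃ E' : ℕ, E' = C * (E + 1) := ⟨_, rfl⟩
  have hE'1 : 1 ≤ E' := by
    rw [hE']
    calc 1 = 1 * 1 := rfl
      _ ≤ C * (E + 1) := Nat.mul_le_mul hC (by omega)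
  -- proviso (b): `s₂(s₂(s₂(n)))^d ≤ t(n)` eventually
  have hb : ∀ᶠ n in atTop,
      ((stretch (fun n => smoothQP k n + n) eₗ)^[3] n) ^ d ≤ smoothQP E n := by
    filter_upwards [eventually_mul_log_add_two_pow_le (d * C₃) B] with n hn
    calc ((stretch (fun n => smoothQP k n + n) eₗ)^[3] n) ^ d
          ≤ 2 ^ ((d * C₃) * (Nat.log 2 n + 2) ^ B) :=
          pow_le_two_pow hs3 d n
      _ ≤ 2 ^ Nat.log 2 n ^ (B + 1) := Nat.pow_le_pow_right two_pos hn
      _ ≤ smoothQP E n := Nat.pow_le_pow_right two_pos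
          ((log_pow_mono (by omega) (by omega : B + 1 ≤ E + 1) n).trans (pow_log_le_qpExp E n))
  -- the new line: `2^{C (log₂ t + 2)^C} ≤ T` eventually, `T = smoothQP E'`
  have hdom : ∀ᶠ n in atTop,
      2 ^ (C * (Nat.log 2 (smoothQP E n) + 2) ^ C) ≤ smoothQP E' n := by
    rw [hE']
    exact eventually_two_pow_mul_log_smoothQP_pow_le_smoothQP C E
  -- the hypothesis: languages of `NTIME T` have `s`-size circuits almost everywhere
  have hsize : ∀ L ∈ NTIME (smoothQP E'),
      ∀ᶠ n in atTop, L.circuitSize n ≤ smoothQP k n + n := by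
    intro L hL
    have hfun : (fun n => smoothQP E' n ^ 1) = smoothQP E' := funext fun n => pow_one _
    have hL1 : L ∈ NTIME (fun n => smoothQP E' n ^ 1) := by rw [hfun]; exact hL
    have hL' := NTIME_smoothQP_pow_subset hE'1 le_rfl hL1
    filter_upwards [hS (E' + 1) (by omega) L hL'] with n hn
    exact hn.trans (two_pow_log_pow_le_smoothQP_add hk n)
  have hw := H (fun n => smoothQP k n + n) (smoothQP E) (smoothQP E')
    (strictMono_smoothQP_add_id k) (isTimeConstructible_smoothQP_add_id hk)
    (isTimeConstructible_smoothQP hE1) (smoothQP_mono E) (isTimeConstructible_smoothQP hE'1)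
    (smoothQP_mono E') (eventually_mul_smoothQP_add_lt k heₗ) hb hdom hsize
  -- descend to the level `e` and enlarge the size bound
  have hw' : NTIMEHasWitnessCircuits (fun n => n ^ Nat.log 2 n ^ e)
      (fun n => ((stretch (fun n => smoothQP k n + n) eₗ)^[3] n) ^ (2 * g)) := hw.of_smoothQP hEe
  intro L hL
  refine (hw' L hL).mono ?_
  filter_upwards [eventually_mul_log_add_two_pow_le (2 * g * C₃) B] with n hn
  exact (pow_le_two_pow hs3 (2 * g) n).trans (Nat.pow_le_pow_right two_pos hn)

/-! ### Theorem 1.2 for `AC⁰[m]` and Theorem 1.3 over the polylogarithmic-seed form -/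

/-- **Murray–Williams' Theorem 1.2 for `AC⁰[m]` (`MurrayWilliams2018_thm_1_2_acc`) from Lemma 4.1
in polylogarithmic-seed form and the exponential-level simulation** `hN` of
`MurrayWilliams2018ExpLevel.lean` (verbatim), by
`MurrayWilliams2018_thm_1_2_acc_of_EWL_of_expSimulation` on
`MurrayWilliams2018_lemma_1_3_of_lemma_4_1_qp`; the hierarchy theorem is the tree's
`Diag.ntime_hierarchy_holds`. [cite: MurrayWilliams2018, Thm. 1.2 (proof, §5)] -/
theorem MurrayWilliams2018_thm_1_2_acc_of_lemma_4_1_qp_of_expSimulation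
    (hQ : ∃ e g d C : ℕ, 1 ≤ e ∧ 1 ≤ g ∧ 1 ≤ d ∧ 1 ≤ C ∧
      ∀ (s t T : ℕ → ℕ), StrictMono s → IsTimeConstructible s → IsTimeConstructible t →
        Monotone t → IsTimeConstructible T → Monotone T →
        (∀ᶠ n in atTop, n * s n < 2 ^ (n / e)) →
        (∀ᶠ n in atTop, ((stretch s e)^[3] n) ^ d ≤ t n) →
        (∀ᶠ n in atTop, 2 ^ (C * (Nat.log 2 (t n) + 2) ^ C) ≤ T n) →
        (∀ L ∈ NTIME T, ∀ᶠ n in atTop, L.circuitSize n ≤ s n) →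
          NTIMEHasWitnessCircuits t (fun n => ((stretch s e)^[3] n) ^ (2 * g)))
    (hN : ∃ c₀ : ℕ, ∀ (d m k r : ℕ), 2 ≤ m → 1 ≤ k → 2 ≤ r →
      AccSatSubexp (d + c₀) m r →
      (Classes.P ⊆ ⋃ a : ℕ,
          DepthSizeClass (accBasis m) (fun _ => d) (fun n => a * 2 ^ Nat.log 2 n ^ k + a)) →
      ∃ q : ℕ, 1 ≤ q ∧ ∀ L ∈ NTIME (fun n => 2 ^ n),
        HasWitnessCircuits (fun n => 2 ^ (n ^ 3)) L (fun n => 2 ^ Nat.nthRoot q n) →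
        L ∈ NTIME williamsBound) :
    MurrayWilliams2018_thm_1_2_acc :=
  MurrayWilliams2018_thm_1_2_acc_of_EWL_of_expSimulation
    (MurrayWilliams2018_lemma_1_3_of_lemma_4_1_qp hQ) hN

/-- **Theorem 1.3 (threshold-free form, `MurrayWilliams2018_NTIME_not_depth_ACC`) from Lemma 4.1
in polylogarithmic-seed form, the exponential-level simulation and Thm. 5.1** (the `ACC`-SAT
algorithm for subexponential size, `MurrayWilliams2018_thm_5_1` — a theorem of the tree,
`MurrayWilliams2018_thm_5_1_holds` in `Williams2014Proofs.lean`, kept as a hypothesis here only to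
spare this glue file that import closure), by `MurrayWilliams2018_NTIME_not_depth_ACC_of_components`.
[cite: MurrayWilliams2018, Thm. 1.3 (proof, §5)] -/
theorem MurrayWilliams2018_NTIME_not_depth_ACC_of_lemma_4_1_qp_of_expSimulation
    (hQ : ∃ e g d C : ℕ, 1 ≤ e ∧ 1 ≤ g ∧ 1 ≤ d ∧ 1 ≤ C ∧
      ∀ (s t T : ℕ → ℕ), StrictMono s → IsTimeConstructible s → IsTimeConstructible t →
        Monotone t → IsTimeConstructible T → Monotone T →
        (∀ᶠ n in atTop, n * s n < 2 ^ (n / e)) →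
        (∀ᶠ n in atTop, ((stretch s e)^[3] n) ^ d ≤ t n) →
        (∀ᶠ n in atTop, 2 ^ (C * (Nat.log 2 (t n) + 2) ^ C) ≤ T n) →
        (∀ L ∈ NTIME T, ∀ᶠ n in atTop, L.circuitSize n ≤ s n) →
          NTIMEHasWitnessCircuits t (fun n => ((stretch s e)^[3] n) ^ (2 * g)))
    (hN : ∃ c₀ : ℕ, ∀ (d m k r : ℕ), 2 ≤ m → 1 ≤ k → 2 ≤ r →
      AccSatSubexp (d + c₀) m r →
      (Classes.P ⊆ ⋃ a : ℕ,
          DepthSizeClass (accBasis m) (fun _ => d) (fun n => a * 2 ^ Nat.log 2 n ^ k + a)) →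
      ∃ q : ℕ, 1 ≤ q ∧ ∀ L ∈ NTIME (fun n => 2 ^ n),
        HasWitnessCircuits (fun n => 2 ^ (n ^ 3)) L (fun n => 2 ^ Nat.nthRoot q n) →
        L ∈ NTIME williamsBound)
    (h51 : MurrayWilliams2018_thm_5_1) : MurrayWilliams2018_NTIME_not_depth_ACC :=
  MurrayWilliams2018_NTIME_not_depth_ACC_of_components
    (MurrayWilliams2018_thm_1_2_acc_of_lemma_4_1_qp_of_expSimulation hQ hN) h51

end Literature.Computability.Complexity
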